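import Literature.AnabelianGeometry.SemiGraphs.ProSigmaCompletionMalnormal
import Literature.AnabelianGeometry.SemiGraphs.ProSigmaCuspInertiaDisjointTwo
import Literature.AnabelianGeometry.SemiGraphs.ProSigmaCuspInertia
import Literature.AnabelianGeometry.SemiGraphs.SurfaceTypeEstranged
import Literature.GroupTheory.CombinatorialGroupTheory.PuncturedSurfaceGroupCuspBases
import HarnessLib

/-!
# Malnormality of cusp inertia in pro-`Σ` punctured surface groups with at least two cusps

[SemiAnbd] Example 2.10 (p. 31) / [AbsAnab] Lemma 1.3.7: abc-iut-L3-t11's named fact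
`ProSigmaCuspInertiaMalnormal` (`SurfaceTypeEstranged.lean`; the group-theoretic input of "totally
estranged") says that in a pro-`Σ` completion `ι : Γ_{g,r} → P` of a hyperbolic punctured surface group
the closed cusp inertia subgroups `I_i = closure ι⟨c_i⟩` are infinite and satisfy `I_i ∩ x I_j x⁻¹ = 1`
whenever `i ≠ j` or `x ∉ I_i` [cite: MochizukiSemiAnbd2006, Ex. 2.10 p.31].

* `cuspInertia_closure_inf_conj_self_eq_bot` — **malnormality for `r ≥ 2`**: `I_i ∩ x I_i x⁻¹ = 1` for
  `x ∉ I_i` (every `c_i` is a member of a free basis of `Γ_{g,r}`,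
  `PuncturedSurfaceGroup.exists_freeGroupBasis_eq_c`, and the closed procyclic subgroup of a free basis
  element is malnormal, `IsProSigmaCompletion.closure_zpowers_inf_conj_eq_bot`);
* `cuspInertia_closure_inf_conj_eq_bot_of_ne_any` — the `i ≠ j` clause for EVERY `r` (abc-iut-L5-t9's `r ≥ 3`
  + `cuspInertia_closure_inf_conj_eq_bot_two` for `r = 2`; `r ≤ 1` has no two cusps);
* `proSigmaCuspInertiaMalnormal_of_onePunctured` — the named fact ASSEMBLED from abc-iut-L5-t9's clause
  (A) and the above, CONDITIONAL only on the malnormality clause for ONCE-punctured types `(g, 1)`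
  (where `c₁ = ([a₁,b₁]⋯[a_g,b_g])⁻¹` is not a free basis element) — stated as the explicit hypothesis
  `hone`, discharged in a later file.

Theorems only; classical profinite group theory; no side is taken on [IUTchIII] Cor. 3.12.
-/

namespace Literature.AnabelianGeometry.SemiGraphs.SemiGraphOfAnabelioids

open Literature.AnabelianGeometry.Anabelioids Literature.GroupTheory.CombinatorialGroupTheory
open scoped Pointwise

universe v

variable {Sigma : Set ℕ} {g r : ℕ} {P : Type v} [Group P] [TopologicalSpace P] [IsTopologicalGroup P]
  [CompactSpace P] [T2Space P] [TotallyDisconnectedSpace P]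

/-- **Malnormality of cusp inertia, `r ≥ 2`.**  For a pro-`Σ` completion `ι : Γ_{g,r} → P` (`P`
profinite) with `r ≥ 2`, a cusp `i` and `x ∉ I_i = closure ι⟨c_i⟩`: `I_i ∩ x I_i x⁻¹ = 1`.
[cite: MochizukiSemiAnbd2006, Ex. 2.10 p.31] -/
theorem cuspInertia_closure_inf_conj_self_eq_bot (hr : 2 ≤ r) (ι : PuncturedSurfaceGroup g r →* P)
    (hι : IsProSigmaCompletion Sigma ι) (i : Fin r) {x : P}
    (hx : x ∉ ((PuncturedSurfaceGroup.cuspInertia (g := g) i).map ι).topologicalClosure) :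
    ((PuncturedSurfaceGroup.cuspInertia (g := g) i).map ι).topologicalClosure ⊓
        ConjAct.toConjAct x •
          ((PuncturedSurfaceGroup.cuspInertia (g := g) i).map ι).topologicalClosure = ⊥ := by
  obtain ⟨β, bs, k, hk⟩ := PuncturedSurfaceGroup.exists_freeGroupBasis_eq_c (g := g) hr i
  simp only [PuncturedSurfaceGroup.cuspInertia, MonoidHom.map_zpowers, ← hk] at hx ⊢
  exact IsProSigmaCompletion.closure_zpowers_inf_conj_eq_bot bs k hι hx

/-- **Distinct cusps have disjoint inertia up to conjugacy, every `r`.**  For a pro-`Σ` completion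
`ι : Γ_{g,r} → P` (`P` profinite) of a hyperbolic type, `i ≠ j` and any `x`: `I_i ∩ x I_j x⁻¹ = 1`.
[cite: MochizukiSemiAnbd2006, Ex. 2.10 p.31] -/
theorem cuspInertia_closure_inf_conj_eq_bot_of_ne_any (h : PuncturedSurfaceGroup.IsHyperbolicType g r)
    (ι : PuncturedSurfaceGroup g r →* P) (hι : IsProSigmaCompletion Sigma ι) {i j : Fin r}
    (hij : i ≠ j) (x : P) :
    ((PuncturedSurfaceGroup.cuspInertia (g := g) i).map ι).topologicalClosure ⊓
        ConjAct.toConjAct x •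
          ((PuncturedSurfaceGroup.cuspInertia (g := g) j).map ι).topologicalClosure = ⊥ := by
  rcases Nat.lt_or_ge r 3 with hr | hr
  · -- `r ≤ 2`; two distinct cusps force `r = 2`
    have hr2 : r = 2 := by
      have : 2 ≤ r := by
        by_contra hlt
        have : Subsingleton (Fin r) := by
          rcases Nat.lt_or_ge r 2 with h2 | h2
          · interval_cases r <;> infer_instance
          · exact absurd h2 hlt
        exact hij (Subsingleton.elim i j)
      omega
    subst hr2
    exact IsProSigmaCompletion.cuspInertia_closure_inf_conj_eq_bot_two h ι hι hij x
  · -- abc-iut-L5-t9's cusp characters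
    exact cuspInertia_closure_inf_conj_eq_bot_of_ne hr ι hι hij x

/-- **`ProSigmaCuspInertiaMalnormal` modulo the once-punctured malnormality clause.**  abc-iut-L3-t11's
named fact assembled from: clause (A) (abc-iut-L5-t9, `infinite_cuspInertia_closure`), the `i ≠ j`
clause (`cuspInertia_closure_inf_conj_eq_bot_of_ne_any`, all `r`), and malnormality for `r ≥ 2`
(`cuspInertia_closure_inf_conj_self_eq_bot`); the ONLY remaining input is the malnormality of the single
cusp inertia subgroup of the ONCE-punctured types `(g, 1)`, `g ≥ 1` — hypothesis `hone`, verbatim the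
`r = 1`, `i = j` instance of the fact. [cite: MochizukiSemiAnbd2006, Ex. 2.10 p.31] -/
theorem proSigmaCuspInertiaMalnormal_of_onePunctured
    (hone : ∀ (Sigma : Set ℕ), Sigma.Nonempty → (∀ p ∈ Sigma, p.Prime) →
      ∀ (g : ℕ), PuncturedSurfaceGroup.IsHyperbolicType g 1 →
        ∀ (P : Type v) [Group P] [TopologicalSpace P] [IsTopologicalGroup P] [CompactSpace P]
          [T2Space P] [TotallyDisconnectedSpace P] (ι : PuncturedSurfaceGroup g 1 →* P),
          IsProSigmaCompletion Sigma ι →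
            ∀ x : P, x ∉ ((PuncturedSurfaceGroup.cuspInertia (g := g) (0 : Fin 1)).map ι).topologicalClosure →
              ((PuncturedSurfaceGroup.cuspInertia (g := g) (0 : Fin 1)).map ι).topologicalClosure ⊓
                ConjAct.toConjAct x •
                  ((PuncturedSurfaceGroup.cuspInertia (g := g) (0 : Fin 1)).map ι).topologicalClosure
                = ⊥) :
    ProSigmaCuspInertiaMalnormal.{v} := by
  intro Sigma hne hprime g r h P _ _ _ _ _ _ ι hι i j
  refine ⟨infinite_cuspInertia_closure hne hprime h ι hι i, fun x hx => ?_⟩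
  by_cases hij : i = j
  · subst hij
    have hxI : x ∉ ((PuncturedSurfaceGroup.cuspInertia (g := g) i).map ι).topologicalClosure := by
      rcases hx with hx | hx
      · exact absurd rfl hx
      · exact hx
    rcases Nat.lt_or_ge r 2 with hr | hr
    · -- `r = 1` (a cusp exists, so `r ≠ 0`)
      have hr1 : r = 1 := by have := i.2; omega
      subst hr1
      have hi : i = 0 := Subsingleton.elim i 0
      subst hi
      exact hone Sigma hne hprime g h P ι hι x hxI
    · exact cuspInertia_closure_inf_conj_self_eq_bot hr ι hι i hxI
  · exact cuspInertia_closure_inf_conj_eq_bot_of_ne_any h ι hι hij x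

end Literature.AnabelianGeometry.SemiGraphs.SemiGraphOfAnabelioids
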